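import Summits.QuantumFields.YangMills.Theorems.UnitScaleTiltProp7SymAvgTwEq137
import Summits.QuantumFields.YangMills.Theorems.UnitScaleTiltProp7ChartSigmaT3
import Summits.QuantumFields.YangMills.Theorems.UnitScaleTiltProp7DbarTwWindow
import Summits.QuantumFields.YangMills.Theorems.UnitScaleTiltProp7PV3CDELogChart
import Summits.QuantumFields.YangMills.Theorems.UnitScaleTiltProp7B8Prop7Div
import Summits.QuantumFields.YangMills.Theorems.UnitScaleTiltProp7SPrintDefs
import HarnessLib

/-!
# Route `UnitScaleTilt`, crux K1 «MinimiserStabilityRegPr» (stmt-QuantumFields-19200) — ARCHITECTURE (A′) ON Σ (RULING g29-№16), THE Σ-IDENTITY IN COMB LETTERS: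
# on the growth socket's binder (`W ∈ (6)(e) ∩ 𝔅_k(V)`, (19) `In19`, (20) `AvgCondPrint`) print's twisted log-chart VANISHES, `log U̿^{tw}_W(iX) = 0`, hence `Q(W)(iX) = −C(W, iX)`:
# the linearised twisted average of a Σ-representative IS minus its second-order chart remainder ([Balaban1985Variational] (20) with `B = 0`, (44))

Cell `ym3-torus` ∕ fleet seat `ym-ust-19200-p1` (gen 17, route-R E′ lead ∕ namer).  THEOREMS ONLY (0 `def`, 0 `sorry`); `--supports stmt-QuantumFields-19200`, count-neutral.
YM₃ on T³ is a ladder rung (R3), not the Clay problem; nothing here claims the stub, the crux, `hcoS`, d = 4 or the mass gap.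

WHY (namer WORDS 18–21).  After LOCATE v3 the growth socket is `hcoS` ((141)–(142) on Σ-representatives; ✓`Prop7HcoWOfHcoSigma.hcoW_of_hcoSigma`), knitted from Σ-rows by
✓`Prop7HcoSOfSigmaRows.hcoS_of_sigmaRowsS`.  Two of those rows — JOINT (the P-A2 binder bounds `Σ_c‖C(W, iX) c‖`) and QSMALL (the averaging penalty `aQ‖Q_c X̃‖²` with the COMB
twisted `Q_c`) — read the member through ONE identity: on Σ, `Q(W)(iX) = −C(W, iX)`.  It holds because (20) `AvgCondPrint V W X` supplies a (1.29)-restricted axial witness `u`, whence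
(1.37)^cov at every comparison bond (✓`Prop7ChartSigmaT3.eq137cov_of_avgCond_witness`), whence print's log form `log U̿^{tw}_W(iX)(c) = log(V(c)·W̄(c)⁻¹)` (✓`Prop7SymAvgTwEq137.
logChartTw_eq_mlog_iff_eq137cov`, inside the `log` windows supplied by ✓`Prop7DbarTwWindow.dbarTw_window_of_regPr` from (19)), and `W̄ = V` on the fibre (`B = 0`, p.299).

WHAT IS PROVED (ns `…Theorems.Prop7SigmaIdentityComb`): ★★ `logChartTw_eq_zero_of_sigma` — `logChartTw F n K h W (I•X) = 0`; ★★★ `QTw_eq_neg_CmapTw_of_sigma` — `QTw F n K h W (I•X)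
= −CmapTw F n K h W (I•X)`; both under `W ∈ regFibrePr F n K h e V`, `In19 F n K ε₂ W (expHermField X) X`, `AvgCondPrint F n K h V W X` and the numeric windows of
✓`dbarTw_window_of_regPr` VERBATIM at `(ε₀, e′) := (e, ε₂)` plus `e ≤ ε₂ ≤ 1∕4`, `10⁷L³·178ε₂ ≤ 1`.
HONEST SCOPE.  Bookkeeping over landed theorems; no estimate; nothing of print asserted beyond the cited tree theorems.

References: T. Bałaban, CMP 102 (1985) 277–309 [Balaban1985Variational] ((19)–(20) p.281, (44) p.285, p.299); CMP 99 (1985) 75–102 [Balaban1985RegularSpaces] ((1.29)–(1.31) pp.81–82,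
(1.37) p.82, p.83); CMP 98 (1985) 17–51 [Balaban1985Averaging] ((84)–(92) p.31); CMP 99 (1985) 389–434 [Balaban1985BackgroundPropagators] ((3.13)–(3.14) p.393).
-/

set_option autoImplicit false
noncomputable section

open scoped BigOperators Matrix.Norms.L2Operator Matrix
open NormedSpace

namespace Summit.QuantumFields.YangMills.Theorems.Prop7SigmaIdentityComb

open Literature.MathematicalPhysics.QuantumFieldTheory.Balaban1983to89
open Literature.MathematicalPhysics.QuantumFieldTheory.Balaban1983to89.T3ContinuumYM3Torus
open T3PrintedRegularMinimiser (RegPr regFibrePr mem_regFibrePr_iff)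
open T3ConstrainedMinimiser (fibre)
open T3TiltDescent (descendTo)
open T3UnitLawDensityEML (ℰp)
open B10Eq27TorusAxialLog (pull unitsField toUField)
open MatrixLog (mlog mlog_one)
open T3SectALandauChart (emb15 eta In19)
open B7Prop2Explicit (C0 c2')
open B7Prop3Flat (c3)
open Summit.QuantumFields.YangMills.Theorems.Prop7TPrint (expHermField nMax19)
open Summit.QuantumFields.YangMills.Theorems.Prop7SPrint (AvgCondPrint)
open Summit.QuantumFields.YangMills.Theorems.Prop7SymAvgTw (logChartTw QTw CmapTw CmapTw_apply)
open Summit.QuantumFields.YangMills.Theorems.Prop7SymAvgTwEq137 (logChartTw_eq_mlog_iff_eq137cov)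
open Summit.QuantumFields.YangMills.Theorems.Prop7ChartSigmaT3 (eq137cov_of_avgCond_witness)
open Summit.QuantumFields.YangMills.Theorems.Prop7DbarTwWindow (dbarTw_window_of_regPr)
open Summit.QuantumFields.YangMills.Theorems.Prop7PV3CDELogChart (nMax19_lt_of_in19)
open Summit.QuantumFields.YangMills.Theorems.Prop7B8Prop7Div (regPr_emb15_of_in19)

variable (F : T3Family) {n K : ℕ} (h : n ≤ K)

set_option maxHeartbeats 400000 in
/-- ★★ **THE Σ-IDENTITY, LOG FORM: `log U̿^{tw}_W(iX) = 0`** for a Σ-representative `X` of the growth socket (`W ∈ (6)(e) ∩ 𝔅_k(V)`, (19) at radius `ε₂`, (20) `AvgCondPrint`), inside the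
windows of ✓`dbarTw_window_of_regPr` at `(ε₀, e′) := (e, ε₂)` — [Balaban1985Variational] (20) «Q_j(U₀, ηA) = B» with `B = 0` (p.299) for the comb twisted chart.
[cite: Balaban1985Variational, (20) p.281, p.299; Balaban1985RegularSpaces, (1.37) p.82, p.83; Balaban1985Averaging, (84)-(92) p.31] -/
theorem logChartTw_eq_zero_of_sigma {e ε₂ : ℝ} (he : 0 < e) (hε₂ : 0 < ε₂) (heε : e ≤ ε₂) (hε₂4 : ε₂ ≤ 1 / 4)
    (hε : 10 ^ 7 * (F.L : ℝ) ^ 3 * e ≤ 1) (h178 : 10 ^ 7 * (F.L : ℝ) ^ 3 * (178 * ε₂) ≤ 1) (he6 : 10 ^ 6 * (F.L : ℝ) ^ 2 * ε₂ ≤ 1)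
    (hα3 : C0 (F.P K).d * (2 * e) ≤ 1 / 3) (hα4 : 4 * (2 * e) ≤ c2' (F.P K).d (F.P K).L)
    (hsmall : Real.exp (4 * (800 * (((F.P K).d : ℝ) + 1) ^ 2 * (((F.P K).d : ℝ) + 4)) * (2 * e))
      * (1 + 8 * (131072 * (((F.P K).d : ℝ) + 1) ^ 2) * ε₂) ≤ 2)
    (hc₃ : 2 * ε₂ ≤ c3 (F.P K).d (F.P K).L) (hsm : 2048 * ((F.P K).d : ℝ) * ε₂ ≤ 1)
    {V : GaugeField (F.P n) 0 (Matrix.specialUnitaryGroup (Fin 2) ℂ)} {W : GaugeField (F.P K) 0 (Matrix.specialUnitaryGroup (Fin 2) ℂ)}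
    (hW : W ∈ regFibrePr F n K h e V) {X : PBond (F.P K) 0 → Matrix (Fin 2) (Fin 2) ℂ}
    (h19 : In19 F n K ε₂ W (expHermField X) X) (h20 : AvgCondPrint F n K h V W X) :
    logChartTw F n K h W (fun b => Complex.I • X b) = 0 := by
  obtain ⟨hWfib, hWreg⟩ := (mem_regFibrePr_iff F).1 hW
  have hX : ∀ b : PBond (F.P K) 0, (X b).IsHermitian ∧ Matrix.trace (X b) = 0 := h19.1
  -- the (1.29)-restricted axial witness of (20) and (1.37)^cov from it
  obtain ⟨u, hR, hA, hfib⟩ := h20 (expHermField X) h19.2.1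
  -- the competitor `e^{iX}W` is printed-regular at `178ε₂`
  have hU₁ : RegPr F n K (178 * ε₂) (emb15 W (expHermField X)) := regPr_emb15_of_in19 (F := F) (n := n) (K := K) hε₂4 heε hWreg h19
  have hWV : descendTo F ℰp n K h W = V := hWfib
  funext c
  -- the `log` windows
  have hwin := dbarTw_window_of_regPr F h he hε₂ hε he6 hα3 hα4 hsmall hc₃ hsm W hWreg X (nMax19_lt_of_in19 h19 le_rfl) c
  have hone : (unitsField (toUField V) c * (unitsField (toUField (descendTo F ℰp n K h W)) c)⁻¹ : (Matrix (Fin 2) (Fin 2) ℂ)ˣ) = 1 := by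
    rw [hWV, mul_inv_cancel]
  have hwinV : ‖((unitsField (toUField V) c * (unitsField (toUField (descendTo F ℰp n K h W)) c)⁻¹ : (Matrix (Fin 2) (Fin 2) ℂ)ˣ) : Matrix (Fin 2) (Fin 2) ℂ) - 1‖ < 1 := by
    rw [hone]; simp
  have h137 := eq137cov_of_avgCond_witness F h u W (expHermField X) V hR hA hfib c
  have hlog := (logChartTw_eq_mlog_iff_eq137cov F h he hε (by positivity) h178 hWreg hX hU₁ V c hwin hwinV).2 h137
  rw [hlog, hone]
  simp

/-- ★★★ **THE Σ-IDENTITY, LINEAR FORM: `Q(W)(iX) = −C(W, iX)`** — on the growth socket's Σ-binder the COMB twisted average of the representative is minus its second-order chart remainder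
((44) `log U̿^{tw} = Q + C` with the left side `0`).  This is the reading through which the JOINT row (P-A2 binder on `Σ_c‖C c‖`) and the QSMALL row (`aQ‖Q_c X̃‖²`, fourth order) see
the member. [cite: Balaban1985Variational, (44) p.285, (20) p.281, p.299; Balaban1985BackgroundPropagators, (3.14) p.393] -/
theorem QTw_eq_neg_CmapTw_of_sigma {e ε₂ : ℝ} (he : 0 < e) (hε₂ : 0 < ε₂) (heε : e ≤ ε₂) (hε₂4 : ε₂ ≤ 1 / 4)
    (hε : 10 ^ 7 * (F.L : ℝ) ^ 3 * e ≤ 1) (h178 : 10 ^ 7 * (F.L : ℝ) ^ 3 * (178 * ε₂) ≤ 1) (he6 : 10 ^ 6 * (F.L : ℝ) ^ 2 * ε₂ ≤ 1)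
    (hα3 : C0 (F.P K).d * (2 * e) ≤ 1 / 3) (hα4 : 4 * (2 * e) ≤ c2' (F.P K).d (F.P K).L)
    (hsmall : Real.exp (4 * (800 * (((F.P K).d : ℝ) + 1) ^ 2 * (((F.P K).d : ℝ) + 4)) * (2 * e))
      * (1 + 8 * (131072 * (((F.P K).d : ℝ) + 1) ^ 2) * ε₂) ≤ 2)
    (hc₃ : 2 * ε₂ ≤ c3 (F.P K).d (F.P K).L) (hsm : 2048 * ((F.P K).d : ℝ) * ε₂ ≤ 1)
    {V : GaugeField (F.P n) 0 (Matrix.specialUnitaryGroup (Fin 2) ℂ)} {W : GaugeField (F.P K) 0 (Matrix.specialUnitaryGroup (Fin 2) ℂ)}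
    (hW : W ∈ regFibrePr F n K h e V) {X : PBond (F.P K) 0 → Matrix (Fin 2) (Fin 2) ℂ}
    (h19 : In19 F n K ε₂ W (expHermField X) X) (h20 : AvgCondPrint F n K h V W X) :
    QTw F n K h W (fun b => Complex.I • X b) = -CmapTw F n K h W (fun b => Complex.I • X b) := by
  have h0 := logChartTw_eq_zero_of_sigma F h he hε₂ heε hε₂4 hε h178 he6 hα3 hα4 hsmall hc₃ hsm hW h19 h20
  rw [CmapTw_apply, h0, zero_sub, neg_neg]

end Summit.QuantumFields.YangMills.Theorems.Prop7SigmaIdentityComb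

end
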